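import Mathlib
import Summits.NavierStokesRegularity.NavierStokesRegularity.Theorems.TypeIQuarterGateScarEnvelopeTypeISatelliteTowerGalleryTransitive

/-!
# Gallery maps preserve the A–B class and its budget; root ω-limits of A–B objects

First: the class `ABTower M` is invariant under every gallery map `U ↦ zoom U x 0 l` with the SAME
rate and the SAME budget `𝐈` (`ABTower.galleryMap`, `typeIBound_galleryMap`).  Then:

The ROOT ω-LIMIT SET `ω_root(U)` of the root-zoom semiflow `T_λ V := zoom V 0 0 λ` (crux idea
`Cruxes/ScarEnvelopeTypeI/Ideas/zoom-recurrence.md`, ns-idea-17 g0; tree predicate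
`IsRootOmegaLimit`, module `…SatelliteTowerGalleryDefs`): root ω-limits are gallery limits;
`ω_root(ω_root(U)) ⊆ ω_root(U)` (transitivity, by the diagonal of `IsGalleryLimit.trans` with null
composite scales); `ω_root(U)` is invariant under every `T_λ`; for an A–B object it is nonempty along
every null sequence of scales and consists (a.e. on every `Q_R(0)`) of A–B objects of the same rate
with `𝐈 ≤ 4·𝐈(U)`, ROOTED whenever `U` is rooted (persistence, A–B Prop. 2.3).

HONEST FRAMING: compactness / dynamics TOOLING about hypothetical Type-I ancient objects for the
crux `TypeIQuarterGate.ScarEnvelopeTypeI` (item 23843); nothing open is proved — 23843,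
`∀ M, ¬ OneScarLeaf M`, `∀ M, ¬ InfiniteDescent M`, the route and Navier–Stokes regularity are OPEN.
LEAD-lineage prover ns-sz-p1 g6; `--supports stmt-NavierStokesRegularity-23843 --as helper`.
-/

noncomputable section

-- the summit-side namespace repeats a component by design (single-conjunct summit, D-0017)
set_option linter.dupNamespace false

open MeasureTheory Set Metric Filter Topology
open scoped ENNReal

namespace Summit.NavierStokesRegularity.NavierStokesRegularity.Cruxes.ScarEnvelopeTypeI.ZoomDictionary

section RootOmega

open Literature.Analysis.FluidPDE
variable {U V W : ℝ → (EuclideanSpace ℝ (Fin 3)) → (EuclideanSpace ℝ (Fin 3))}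
  {P : ℝ → (EuclideanSpace ℝ (Fin 3)) → ℝ}

/-! ### The A–B class is invariant under the gallery maps (budget preserved EXACTLY) -/

/-- The open lower half-space is invariant under the parabolic affine maps based at final time `0`. -/
theorem preimage_stAffine_lowerHalf {l : ℝ} (hl : 0 < l) (x : (EuclideanSpace ℝ (Fin 3))) :
    stAffine (l ^ 2) l 0 x ⁻¹' (Iio (0 : ℝ) ×ˢ (univ : Set (EuclideanSpace ℝ (Fin 3)))) =
      Iio (0 : ℝ) ×ˢ (univ : Set (EuclideanSpace ℝ (Fin 3))) := by
  have hl2 : 0 < l ^ 2 := pow_pos hl 2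
  ext ⟨t, y⟩
  simp only [mem_preimage, stAffine_apply, mem_prod, mem_Iio, mem_univ, and_true, zero_add]
  constructor
  · intro h
    by_contra ht
    exact absurd h (not_lt.2 (mul_nonneg hl2.le (not_lt.1 ht)))
  · intro h
    exact mul_neg_of_pos_of_neg hl2 h

/-- **The budget `𝐈` over the open past is invariant under the gallery maps.** -/
theorem typeIBound_galleryMap (U : ℝ → (EuclideanSpace ℝ (Fin 3)) → (EuclideanSpace ℝ (Fin 3)))
    (P : ℝ → (EuclideanSpace ℝ (Fin 3)) → ℝ)
    (H : ℝ → (EuclideanSpace ℝ (Fin 3)) → (EuclideanSpace ℝ (Fin 3)) →L[ℝ] (EuclideanSpace ℝ (Fin 3)))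
    (x : (EuclideanSpace ℝ (Fin 3))) {l : ℝ} (hl : 0 < l) :
    typeIBound (Iio (0 : ℝ) ×ˢ univ) (zoom U x 0 l) (zoomP P x 0 l) (l ^ 2 • stPull (l ^ 2) l 0 x H) =
      typeIBound (Iio (0 : ℝ) ×ˢ univ) U P H := by
  rw [zoom_eq_smul_stPull, zoomP_eq_smul_stPull, ← typeIBound_nsZoom hl 0 x
    (Iio (0 : ℝ) ×ˢ (univ : Set (EuclideanSpace ℝ (Fin 3)))) U P H, preimage_stAffine_lowerHalf hl x]

/-- **The A–B class `ABTower M` is invariant under every gallery map** `U ↦ zoom U x 0 l`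
(`x ∈ ℝ³`, `l > 0`), with the SAME rate `M` and the SAME budget `𝐈` (KNSS scaling/translation
invariance of the Type-I ancient mild class, translation invariance of the class on all balls,
transport of weak gradients, scale invariance of `𝐈` over the open past). -/
theorem ABTower.galleryMap {M : ℝ}
    {H : ℝ → (EuclideanSpace ℝ (Fin 3)) → (EuclideanSpace ℝ (Fin 3)) →L[ℝ] (EuclideanSpace ℝ (Fin 3))}
    (h : ABTower M U P H) (x : (EuclideanSpace ℝ (Fin 3))) {l : ℝ} (hl : 0 < l) :
    ABTower M (zoom U x 0 l) (zoomP P x 0 l) (l ^ 2 • stPull (l ^ 2) l 0 x H) := by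
  obtain ⟨hmild, hIB, hH, hI⟩ := h
  refine ⟨?_, fun a ha => inBall_zoom_of_inBall hIB x hl ha, ?_, ?_⟩
  · have e : zoom U x 0 l = nsRescale l (fun t y => U t (y + x)) := by
      funext s y
      simp only [zoom, nsRescale_apply, zero_add, add_comm x]
    rw [e]
    exact (hmild.comp_add_right x).nsRescale hl
  · have h1 := hH.stRescale l (β := l ^ 2) (γ := l) (pow_pos hl 2) hl 0 x
    have hpre : stPreimage (l ^ 2) l 0 x (slab (EuclideanSpace ℝ (Fin 3)) (Iio 0) isOpen_Iio) =
        slab (EuclideanSpace ℝ (Fin 3)) (Iio 0) isOpen_Iio := by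
      refine TopologicalSpace.Opens.ext ?_
      rw [coe_stPreimage, coe_slab]
      exact preimage_stAffine_lowerHalf hl x
    rw [hpre, show l * l = l ^ 2 by ring, ← zoom_eq_smul_stPull] at h1
    exact h1
  · rw [typeIBound_galleryMap U P H x hl]
    exact hI

/-- Gallery limits of `U` are mapped to gallery limits of `U` by the gallery maps, inside the
A–B class and with the same budget: the A–B representative of `zoom W y 0 m`. -/
theorem IsGalleryLimit.galleryMap_abTower {M : ℝ}
    {W : ℝ → (EuclideanSpace ℝ (Fin 3)) → (EuclideanSpace ℝ (Fin 3))} {PW : ℝ → (EuclideanSpace ℝ (Fin 3)) → ℝ}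
    {HW : ℝ → (EuclideanSpace ℝ (Fin 3)) → (EuclideanSpace ℝ (Fin 3)) →L[ℝ] (EuclideanSpace ℝ (Fin 3))}
    (hg : IsGalleryLimit U W) (hW : ABTower M W PW HW) (y : (EuclideanSpace ℝ (Fin 3))) {m : ℝ}
    (hm : 0 < m) :
    IsGalleryLimit U (zoom W y 0 m) ∧
      ABTower M (zoom W y 0 m) (zoomP PW y 0 m) (m ^ 2 • stPull (m ^ 2) m 0 y HW) ∧
      typeIBound (Iio (0 : ℝ) ×ˢ univ) (zoom W y 0 m) (zoomP PW y 0 m)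
        (m ^ 2 • stPull (m ^ 2) m 0 y HW) = typeIBound (Iio (0 : ℝ) ×ˢ univ) W PW HW :=
  ⟨hg.galleryMap y hm, hW.galleryMap y hm, typeIBound_galleryMap W PW HW y hm⟩

/-! ### Root ω-limits -/

/-- Root ω-limits are gallery limits. -/
theorem IsRootOmegaLimit.isGalleryLimit (h : IsRootOmegaLimit U W) : IsGalleryLimit U W := by
  obtain ⟨hW3, l, hl, -, hconv⟩ := h
  exact ⟨hW3, fun _ => 0, l, hl, hconv⟩

/-- **Root ω-limits of root ω-limits are root ω-limits** (`ω_root(ω_root(U)) ⊆ ω_root(U)`, the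
closedness of the root ω-limit set under the root-zoom semiflow's own limits; same diagonal as
`IsGalleryLimit.trans`, with the first index forced to infinity and the scales of the second stage
kept `≤ 1`, so that the composite scales are again a null sequence). -/
theorem IsRootOmegaLimit.trans
    (hU : ∀ R : ℝ, 0 < R → AEStronglyMeasurable (Function.uncurry U)
      (volume.restrict (parabolicCylinder R (0 : ℝ × (EuclideanSpace ℝ (Fin 3))))))
    (hUV : IsRootOmegaLimit U V) (hVW : IsRootOmegaLimit V W) : IsRootOmegaLimit U W := by
  obtain ⟨hV3, l, hl, hl0, hxV⟩ := hUV
  obtain ⟨hW3, m, hm, hm0, hyW⟩ := hVW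
  refine ⟨hW3, ?_⟩
  set Q : ℕ → Set (ℝ × (EuclideanSpace ℝ (Fin 3))) :=
    fun n => parabolicCylinder ((n : ℝ) + 1) (0 : ℝ × (EuclideanSpace ℝ (Fin 3))) with hQ
  have hnpos : ∀ n : ℕ, (0 : ℝ) < (n : ℝ) + 1 := fun n => by positivity
  have hθ : ∀ n : ℕ, (0 : ℝ≥0∞) < ((n : ℝ≥0∞) + 1)⁻¹ := fun n =>
    ENNReal.inv_pos.2 (by simp)
  -- first choice: `i n ≥ n` with `‖zoom V 0 (m i) − W‖_{L³(Q_{n+1})} ≤ (n+1)⁻¹`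
  have hex1 : ∀ n : ℕ, ∃ i : ℕ, eLpNorm (Function.uncurry (zoom V 0 0 (m i)) - Function.uncurry W) 3
      (volume.restrict (Q n)) ≤ ((n : ℝ≥0∞) + 1)⁻¹ ∧ n ≤ i := fun n =>
    (((ENNReal.tendsto_nhds_zero.1 (hyW _ (hnpos n))) _ (hθ n)).and (eventually_ge_atTop n)).exists
  choose i hi hin using hex1
  -- the zoomed family converges to the zoomed limit (gallery map with centre `0`)
  have hstep : ∀ n : ℕ, Tendsto (fun j => eLpNorm (Function.uncurry
      (zoom U 0 0 (l j * m (i n))) - Function.uncurry (zoom V 0 0 (m (i n)))) 3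
      (volume.restrict (Q n))) atTop (𝓝 0) := by
    intro n
    have h := (hxV.galleryMap 0 (hm (i n))) _ (hnpos n)
    simpa only [smul_zero, add_zero] using h
  -- second choice: `j n` with the approximation AND `l (j n) ≤ 1`
  have hex2 : ∀ n : ℕ, ∃ j : ℕ, eLpNorm (Function.uncurry
      (zoom U 0 0 (l j * m (i n))) - Function.uncurry (zoom V 0 0 (m (i n)))) 3
      (volume.restrict (Q n)) ≤ ((n : ℝ≥0∞) + 1)⁻¹ ∧ l j ≤ 1 := fun n =>
    (((ENNReal.tendsto_nhds_zero.1 (hstep n)) _ (hθ n)).and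
      (hl0.eventually (ge_mem_nhds one_pos))).exists
  choose j hj hj1 using hex2
  refine ⟨fun n => l (j n) * m (i n), fun n => mul_pos (hl _) (hm _), ?_, fun R hR => ?_⟩
  · -- the composite scales are a null sequence: `0 < l (j n) m (i n) ≤ m (i n) → 0`
    have him : Tendsto (fun n => m (i n)) atTop (𝓝 0) :=
      hm0.comp (tendsto_atTop_mono hin tendsto_id)
    refine squeeze_zero (fun n => (mul_pos (hl _) (hm _)).le) (fun n => ?_) him
    exact (mul_le_of_le_one_left (hm _).le (hj1 n))
  -- the diagonal sequence converges on every `Q_R(0)`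
  have hbound : ∀ n : ℕ, R ≤ (n : ℝ) + 1 →
      eLpNorm (Function.uncurry (zoom U ((fun _ : ℕ => (0 : EuclideanSpace ℝ (Fin 3))) n) 0
          (l (j n) * m (i n))) - Function.uncurry W) 3
          (volume.restrict (parabolicCylinder R (0 : ℝ × (EuclideanSpace ℝ (Fin 3))))) ≤
        ((n : ℝ≥0∞) + 1)⁻¹ + ((n : ℝ≥0∞) + 1)⁻¹ := by
    intro n hn
    have hsub : parabolicCylinder R (0 : ℝ × (EuclideanSpace ℝ (Fin 3))) ⊆ Q n :=
      parabolicCylinder_mono hR.le hn _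
    refine le_trans (eLpNorm_mono_measure _ (Measure.restrict_mono hsub le_rfl)) ?_
    have hA : AEStronglyMeasurable (Function.uncurry (zoom U 0 0 (l (j n) * m (i n))))
        (volume.restrict (Q n)) :=
      aestronglyMeasurable_uncurry_zoom hU _ (mul_pos (hl _) (hm _)) (hnpos n)
    have hB : AEStronglyMeasurable (Function.uncurry (zoom V 0 0 (m (i n))))
        (volume.restrict (Q n)) :=
      aestronglyMeasurable_uncurry_zoom (fun R hR => (hV3 R hR).1) _ (hm _) (hnpos n)
    have hC : AEStronglyMeasurable (Function.uncurry W) (volume.restrict (Q n)) := (hW3 _ (hnpos n)).1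
    have e : Function.uncurry (zoom U 0 0 (l (j n) * m (i n))) - Function.uncurry W =
        (Function.uncurry (zoom U 0 0 (l (j n) * m (i n))) - Function.uncurry (zoom V 0 0 (m (i n)))) +
        (Function.uncurry (zoom V 0 0 (m (i n))) - Function.uncurry W) := by abel
    show eLpNorm (Function.uncurry (zoom U 0 0 (l (j n) * m (i n))) - Function.uncurry W) 3
        (volume.restrict (Q n)) ≤ _
    rw [e]
    exact (eLpNorm_add_le (hA.sub hB) (hB.sub hC) (by norm_num)).trans (add_le_add (hj n) (hi n))
  have hθ0 : Tendsto (fun n : ℕ => ((n : ℝ≥0∞) + 1)⁻¹ + ((n : ℝ≥0∞) + 1)⁻¹) atTop (𝓝 0) := by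
    have h1 : Tendsto (fun n : ℕ => ((n : ℝ≥0∞) + 1)⁻¹) atTop (𝓝 0) := by
      have h := ENNReal.tendsto_inv_nat_nhds_zero.comp (tendsto_add_atTop_nat 1)
      refine h.congr fun n => ?_
      simp only [Function.comp_apply, Nat.cast_add, Nat.cast_one]
    simpa using h1.add h1
  refine ENNReal.tendsto_nhds_zero.2 fun ε hε => ?_
  obtain ⟨N, hN⟩ := exists_nat_ge R
  filter_upwards [(ENNReal.tendsto_nhds_zero.1 hθ0) ε hε, eventually_ge_atTop N] with n hn hnN
  refine (hbound n ?_).trans hn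
  calc R ≤ (N : ℝ) := hN
    _ ≤ (n : ℝ) := by exact_mod_cast hnN
    _ ≤ (n : ℝ) + 1 := by linarith

/-- A root ω-limit of `U` stays a root ω-limit after a ROOT zoom (the root ω-limit set is
invariant under the root-zoom semiflow `T_λ`). -/
theorem IsRootOmegaLimit.rootZoom (hUV : IsRootOmegaLimit U V) {lam : ℝ} (hlam : 0 < lam) :
    IsRootOmegaLimit U (zoom V 0 0 lam) := by
  obtain ⟨hV3, l, hl, hl0, hconv⟩ := hUV
  refine ⟨hV3.galleryMap 0 hlam, fun j => l j * lam, fun j => mul_pos (hl j) hlam, ?_, ?_⟩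
  · simpa using hl0.mul_const lam
  · have h := hconv.galleryMap 0 hlam
    simpa only [smul_zero, add_zero] using h

/-- **Root ω-limit sets of A–B objects are nonempty** (along a subsequence of any null sequence
of scales), and consist of A–B objects of the same rate with `𝐈 ≤ 4·𝐈(U)`. -/
theorem ABTower.exists_isRootOmegaLimit {M : ℝ}
    {H : ℝ → (EuclideanSpace ℝ (Fin 3)) → (EuclideanSpace ℝ (Fin 3)) →L[ℝ] (EuclideanSpace ℝ (Fin 3))}
    (h : ABTower M U P H) {l : ℕ → ℝ} (hl : ∀ k, 0 < l k) (hl0 : Tendsto l atTop (𝓝 0)) :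
    ∃ (U' : ℝ → (EuclideanSpace ℝ (Fin 3)) → (EuclideanSpace ℝ (Fin 3))) (P' : ℝ → (EuclideanSpace ℝ (Fin 3)) → ℝ)
      (H' : ℝ → (EuclideanSpace ℝ (Fin 3)) → (EuclideanSpace ℝ (Fin 3)) →L[ℝ] (EuclideanSpace ℝ (Fin 3)))
      (σ : ℕ → ℕ), StrictMono σ ∧ ABTower M U' P' H' ∧
      typeIBound (Iio (0 : ℝ) ×ˢ univ) U' P' H' ≤ 4 * typeIBound (Iio (0 : ℝ) ×ˢ univ) U P H ∧
      IsRootOmegaLimit U U' ∧ ZoomsTendsto U (fun _ => 0) (l ∘ σ) U' := by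
  obtain ⟨U', P', H', σ, hσ, hAB, h4, hmem, hconv, -⟩ := abTower_galleryCompact h (fun _ => 0) hl
  exact ⟨U', P', H', σ, hσ, hAB, h4, ⟨hmem, l ∘ σ, fun j => hl _, hl0.comp hσ.tendsto_atTop, hconv⟩,
    hconv⟩

/-- **Root ω-limits of ROOTED A–B objects are rooted A–B objects** with `𝐈 ≤ 4·𝐈(U)`: the root
scar persists in every root ω-limit (A–B Prop. 2.3 via the persistence clause of
`abTower_of_galleryLimit`, the zooms `zoom U 0 0 (l j)` being singular at the origin with `U`). -/
theorem abTower_of_isRootOmegaLimit {M : ℝ}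
    {H : ℝ → (EuclideanSpace ℝ (Fin 3)) → (EuclideanSpace ℝ (Fin 3)) →L[ℝ] (EuclideanSpace ℝ (Fin 3))}
    (h : ABTower M U P H) (h0 : ¬ RegPt U 0) (hW : IsRootOmegaLimit U W) :
    ∃ (U' : ℝ → (EuclideanSpace ℝ (Fin 3)) → (EuclideanSpace ℝ (Fin 3))) (P' : ℝ → (EuclideanSpace ℝ (Fin 3)) → ℝ)
      (H' : ℝ → (EuclideanSpace ℝ (Fin 3)) → (EuclideanSpace ℝ (Fin 3)) →L[ℝ] (EuclideanSpace ℝ (Fin 3))),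
      ABTower M U' P' H' ∧
      typeIBound (Iio (0 : ℝ) ×ˢ univ) U' P' H' ≤ 4 * typeIBound (Iio (0 : ℝ) ×ˢ univ) U P H ∧
      (∀ R : ℝ, 0 < R → ∀ᵐ z ∂(volume.restrict (parabolicCylinder R (0 : ℝ × (EuclideanSpace ℝ (Fin 3))))),
        W z.1 z.2 = U' z.1 z.2) ∧
      ¬ RegPt U' 0 := by
  obtain ⟨hW3, l, hl, -, hconv⟩ := hW
  obtain ⟨U', P', H', hAB, h4, hae, hpers⟩ := abTower_of_galleryLimit h (fun _ => 0) hl hW3 hconv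
  refine ⟨U', P', H', hAB, h4, hae, hpers 0 (Eventually.of_forall fun j hr => ?_)⟩
  exact h0 (regPt_of_regPt_zoom_zero (hl j) hr)

end RootOmega

end Summit.NavierStokesRegularity.NavierStokesRegularity.Cruxes.ScarEnvelopeTypeI.ZoomDictionary
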